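import Summits.CriticalPhenomena.PercolationContinuityZ3.Theorems.PercNearOneGluingNoHeavyQuantRootPatternDead
import Summits.CriticalPhenomena.PercolationContinuityZ3.Theorems.PercNearOneGluingNoHeavyQuantForestPerm
import HarnessLib

/-!
# QUANT lane R8, T-DEC: GROUP-SPLIT RE-GATING, k-GENERAL — the two-root identity with a GROUP of siblings as the hub
# (`hub_gateCoupling`): `gate_a(G_K ∗ G_J) = w·(gate_a G_K ∗ gate_a G_J) + (1−w)·gate_{a g₁}(gate_{1/g₁} G_K ∗ cond G_J)`; every piece certified
# by the oracle; the sibling step's conclusion for all outer gates `a ≤ Smin J / S` whenever the hub group dominates (`pdead J ≤ pdead K`)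

builds on p205010 (kernel theorem, internal audit signed; external expert review pending)

Support file (`--supports stmt-CriticalPhenomena-4575`), QUANT lane typer seat prim-quant-stmt (gen 39), rung R8 of
`run/shared/lean/prim/quant/LADDER.md`.  Theorems only, standard axioms, no sorries.  Uses typer g39's list binder and engine (`…ForestData`,
`…ForestPerm`: `flaw_append`; `…RegateMixture`: `decAt_gate_of_regate`; `…RootPatternDead`: `flaw_rootPattern_dead`, `cond`, `pdead`,
`hub_gateCoupling`, append lemmas), CW's `convClosedT_holds` (`decAt_lconv_of_convClosedT`), census-2's `lconv_top_left_of_le`.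

* `decAtT_gate_lconv_gate` — the PRODUCT piece `gate_a G₂ ∗ gate_a G₁` of two SDEC laws is DEC at every layer at floor `a·x`, target `a(S₂+S₁)`;
* `group_residual_mixture` — the RESIDUAL law `gate_{1/g₁} G_K ∗ cond G_J` (`g₁ = 1 − pdead J`, hub group dominating) as a finite mixture of
  opened root patterns `R_{V₂} ∗ R_{V₁}` (`V₁ ≠ ∅`), each tree-built with fewer gates than the forest, with means in `[Smin J, Stot (J ++ K)]`;
  `decAt_group_residual` — hence, by `decAt_gate_of_regate` with the node's oracle, `gate_{a g₁}` of it is DEC at every layer at floor `a·x`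
  in the regime `a·fmean (J ++ K) ≤ Smin J` under the floor check `x·Stot ≤ fmean·xmin`;
* **`decAt_gate_flaw_group`** (the group-split theorem) and **`sdec_flaw_group`**: if moreover `fmean (J ++ K) ≤ Smin J`, the list form of
  the sibling step HOLDS for `J ++ K` (use `flaw_perm` to bring any hub group to the front).
Coverage (three/four 2-chains, quant/prim-quant-stmt-g39/explore/coverage_group.py): fully-settled share of light-root forests .63 (k = 3) / .40
(k = 4), versus .49 / .22 for the root-pattern family alone.  HONEST STATUS: sub-family; `SiblingStep`, `GateStepN`, `FarTreeRow` OPEN; RATE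
class log\* / honest sentence unchanged.  [this work].  Nothing here is cited as a published result.  The gluing rows served
[cite: KozmaNitzan2024, Conjecture 3 (p. 15)]; product measure [cite: Grimmett1999, §1.3 p. 10].
-/

noncomputable section

open scoped BigOperators

namespace Summit.CriticalPhenomena.PercolationContinuityZ3.Theorems
namespace Quant
namespace LawDec

open Finset

/-! ### The product piece -/

/-- facts of `gate G a` at floor `a·x` from facts of `G` at floor `x` (nonneg, vanishing, mass, pointwise top-affordability). [this work] -/
theorem gate_facts_floor {x a : ℝ} (T : ℕ) (G : ℕ → ℝ) (hx0 : 0 < x) (ha0 : 0 < a) (ha1 : a ≤ 1) (G0 : ∀ h, 0 ≤ G h)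
    (GM : ∀ h, T < h → G h = 0) (G1 : ∑ h ∈ Finset.range (T + 1), G h = 1) (Gta : x * (T : ℝ) ≤ ∑ h ∈ Finset.range (T + 1), (h : ℝ) * G h) :
    (∀ h, 0 ≤ gate G a h) ∧ (∀ h, T < h → gate G a h = 0) ∧ (∑ h ∈ Finset.range (T + 1), gate G a h = 1) ∧
      (∀ h, 0 < gate G a h → (a * x) * (h : ℝ) ≤ ∑ k ∈ Finset.range (T + 1), (k : ℝ) * gate G a k) := by
  refine ⟨fun h => ?_, fun h hh => ?_, sum_gate G a T G1, fun h hh => ?_⟩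
  · rw [gate_apply]; split_ifs <;> nlinarith [G0 h]
  · rw [gate_apply, GM h hh, if_neg (by omega)]; ring
  · rw [sum_mul_gate]
    have hhT : h ≤ T := by
      by_contra hlt
      have : gate G a h = 0 := by rw [gate_apply, GM h (not_le.1 hlt), if_neg (by omega)]; ring
      rw [this] at hh; exact lt_irrefl _ hh
    have h1 : (a * x) * (h : ℝ) ≤ (a * x) * (T : ℝ) := mul_le_mul_of_nonneg_left (by exact_mod_cast hhT) (mul_pos ha0 hx0).le
    nlinarith [mul_le_mul_of_nonneg_left Gta ha0.le]

/-- **THE PRODUCT PIECE**: for SDEC laws `G₁`, `G₂` at floor `x` (probability laws, top-affordable), `gate_a G₂ ∗ gate_a G₁` is DEC at every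
layer `j < T₂ + T₁` at floor `a·x` and target `a·(S₂ + S₁)` (`sdec_gate` + `convClosedT_holds`). [this work] -/
theorem decAtT_gate_lconv_gate {x a : ℝ} {T₁ T₂ : ℕ} {G₁ G₂ : ℕ → ℝ} (hx0 : 0 < x) (hx1 : x < 1) (ha0 : 0 < a) (ha1 : a ≤ 1)
    (f0₁ : ∀ h, 0 ≤ G₁ h) (fM₁ : ∀ h, T₁ < h → G₁ h = 0) (f1₁ : ∑ h ∈ Finset.range (T₁ + 1), G₁ h = 1)
    (ta₁ : x * (T₁ : ℝ) ≤ ∑ h ∈ Finset.range (T₁ + 1), (h : ℝ) * G₁ h)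
    (f0₂ : ∀ h, 0 ≤ G₂ h) (fM₂ : ∀ h, T₂ < h → G₂ h = 0) (f1₂ : ∑ h ∈ Finset.range (T₂ + 1), G₂ h = 1)
    (ta₂ : x * (T₂ : ℝ) ≤ ∑ h ∈ Finset.range (T₂ + 1), (h : ℝ) * G₂ h)
    (hS₁ : SDEC x T₁ G₁) (hS₂ : SDEC x T₂ G₂) (j : ℕ) (hj : j < T₂ + T₁) :
    DECAtT (a * x) (a * (∑ h ∈ Finset.range (T₂ + 1), (h : ℝ) * G₂ h + ∑ h ∈ Finset.range (T₁ + 1), (h : ℝ) * G₁ h)) j (T₂ + T₁)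
      (lconv T₂ T₁ (gate G₂ a) (gate G₁ a)) := by
  obtain ⟨g0₁, gM₁, g1₁, gta₁⟩ := gate_facts_floor T₁ G₁ hx0 ha0 ha1 f0₁ fM₁ f1₁ ta₁
  obtain ⟨g0₂, gM₂, g1₂, gta₂⟩ := gate_facts_floor T₂ G₂ hx0 ha0 ha1 f0₂ fM₂ f1₂ ta₂
  have hax1 : a * x < 1 := by nlinarith
  have hd := decAt_lconv_of_convClosedT convClosedT_holds (a * x) T₂ T₁ (gate G₂ a) (gate G₁ a) (mul_pos ha0 hx0) hax1
    g0₂ gM₂ g1₂ g0₁ gM₁ g1₁ gta₂ gta₁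
    (fun j'' hj'' => by have := (sdec_gate hS₂ a ha0 ha1) 1 one_pos le_rfl j'' hj''; rwa [gate_one, one_mul] at this)
    (fun j'' hj'' => by have := (sdec_gate hS₁ a ha0 ha1) 1 one_pos le_rfl j'' hj''; rwa [gate_one, one_mul] at this) j hj
  rw [decAt_iff_decAtT, sum_mul_lconv T₂ T₁ _ _ g1₂ g1₁, sum_mul_gate, sum_mul_gate] at hd
  rw [mul_add]; exact hd

/-! ### The residual piece as a mixture of opened root patterns -/

/-- **THE RESIDUAL MIXTURE**: for hub group `J ≠ []` and rest `K` (tree-built siblings with root relays, `pdead J ≤ pdead K`), with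
`g₁ = 1 − pdead J`, the law `gate (flaw K) (1/g₁) ∗ cond (flaw J)` is a finite mixture of tree-built pieces (opened root patterns
`R_{V₂} ∗ R_{V₁}`, `V₁ ≠ ∅`) with fewer gates than `fgates (J ++ K)`, means in `[Smin J, Stot (J ++ K)]`, floors `≥ xmin (J ++ K)`, total
weighted mean `fmean (J ++ K)/g₁`. [this work] -/
theorem group_residual_mixture {x : ℝ} (hx0 : 0 < x) (hx1 : x < 1) (J K : List Sib) (hJne : J ≠ [])
    (hJ : ∀ s ∈ J, s.TreeOK x) (hK : ∀ s ∈ K, s.TreeOK x) (hJ0 : ∀ s ∈ J, s.ρ 0 = 0) (hK0 : ∀ s ∈ K, s.ρ 0 = 0)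
    (hdom : pdead J ≤ pdead K) :
    ∃ (ι : Type) (_ : Fintype ι) (π : ι → ℝ) (t m : ι → ℕ) (s y : ι → ℝ) (F : ι → ℕ → ℝ),
      (∀ i, 0 ≤ π i) ∧ (∑ i, π i = 1) ∧
      (∀ h, lconv (ftop K) (ftop J) (gate (flaw K) (1 / (1 - pdead J))) (cond (flaw J)) h = ∑ i, π i * F i h) ∧
      (∑ i, π i * s i = fmean (J ++ K) / (1 - pdead J)) ∧
      (∀ i, t i ≤ ftop K + ftop J ∧ (∀ h, 0 ≤ F i h) ∧ (∀ h, t i < h → F i h = 0) ∧ (∑ h ∈ Finset.range (t i + 1), F i h = 1) ∧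
        (∑ h ∈ Finset.range (t i + 1), (h : ℝ) * F i h = s i) ∧ Smin J ≤ s i ∧ s i ≤ Stot (J ++ K) ∧
        TreeBuiltN (y i) (m i) (t i) (F i) ∧ m i + 1 ≤ fgates (J ++ K) ∧ xmin (J ++ K) ≤ y i ∧ 0 < y i ∧ y i < 1 ∧
        y i * (t i : ℝ) ≤ s i) := by
  classical
  have hJl : ∀ s ∈ J, s.LawOK := fun s hs => (hJ s hs).lawOK
  have hKl : ∀ s ∈ K, s.LawOK := fun s hs => (hK s hs).lawOK
  obtain ⟨hpJ0, _, hpJlt⟩ := pdead_facts J hJl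
  have hpJ1 : pdead J < 1 := hpJlt hJne
  set g₁ : ℝ := 1 - pdead J with hg₁
  have hg0 : 0 < g₁ := by rw [hg₁]; linarith
  obtain ⟨ιJ, _, πJ, tJ, mJ, σJ, yJ, FJ, hπJ0, hπJ1, hmixJ, hπσJ, hPJ⟩ := flaw_rootPattern_dead hx0 hx1 J hJ hJ0
  obtain ⟨ιK, _, πK, tK, mK, σK, yK, FK, hπK0, hπK1, hmixK, hπσK, hPK⟩ := flaw_rootPattern_dead hx0 hx1 K hK hK0
  set d : ℝ := (pdead K - pdead J) / g₁ with hd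
  have hd0 : 0 ≤ d := div_nonneg (by linarith) hg0.le
  have hsumJ : ∑ jj, πJ jj = g₁ := by rw [hg₁]; linarith
  have hsumK : ∑ i, πK i = 1 - pdead K := by linarith
  have hG0 : flaw J 0 = pdead J := flaw_zero_eq_pdead J hJ0
  -- `cond (flaw J) = (1/g₁) Σ πJ FJ`
  have hc : ∀ h, cond (flaw J) h = ∑ jj, (πJ jj / g₁) * FJ jj h := by
    intro h
    simp only [cond]
    by_cases hh : h = 0
    · subst hh; rw [if_pos rfl]; symm
      exact Finset.sum_eq_zero fun jj _ => by rw [(hPJ jj).2.2.2.2.2.2.2.2.2.2.2.2, mul_zero]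
    · rw [if_neg hh, hmixJ h, if_neg hh, mul_zero, zero_add, hG0, Finset.sum_div]
      exact Finset.sum_congr rfl fun jj _ => by rw [hg₁]; ring
  -- `gate (flaw K) (1/g₁) = d δ₀ + Σ (πK/g₁) FK`
  have hY : ∀ h, gate (flaw K) (1 / g₁) h = d * (if h = 0 then (1 : ℝ) else 0) + ∑ i, (πK i / g₁) * FK i h := by
    intro h
    have hs : ∑ i, πK i / g₁ * FK i h = (∑ i, πK i * FK i h) / g₁ := by
      rw [Finset.sum_div]; exact Finset.sum_congr rfl fun i _ => by ring
    have hne : (1 : ℝ) - pdead J ≠ 0 := by linarith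
    rw [gate_apply, hmixK h, hs, hd, hg₁]
    field_simp
    ring
  refine ⟨Option ιK × ιJ, inferInstance,
    fun p => Option.elim p.1 (d * (πJ p.2 / g₁)) (fun i => (πK i / g₁) * (πJ p.2 / g₁)),
    fun p => Option.elim p.1 (tJ p.2) (fun i => tK i + tJ p.2),
    fun p => Option.elim p.1 (mJ p.2) (fun i => mK i + mJ p.2),
    fun p => Option.elim p.1 (σJ p.2) (fun i => σK i + σJ p.2),
    fun p => Option.elim p.1 (yJ p.2) (fun i => min (yK i) (yJ p.2)),
    fun p => Option.elim p.1 (FJ p.2) (fun i => lconv (tK i) (tJ p.2) (FK i) (FJ p.2)), ?_, ?_, ?_, ?_, ?_⟩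
  · rintro ⟨o, jj⟩; cases o <;> simp only [Option.elim]
    · exact mul_nonneg hd0 (div_nonneg (hπJ0 jj) hg0.le)
    · exact mul_nonneg (div_nonneg (hπK0 _) hg0.le) (div_nonneg (hπJ0 jj) hg0.le)
  · -- total weight: (d + Σ πK/g₁) · (Σ πJ)/g₁ = 1
    rw [Fintype.sum_prod_type, Fintype.sum_option]
    simp only [Option.elim]
    have t1 : ∑ jj, d * (πJ jj / g₁) = d * ((∑ jj, πJ jj) / g₁) := by
      rw [Finset.sum_div, Finset.mul_sum]
    have t2 : ∀ i, ∑ jj, πK i / g₁ * (πJ jj / g₁) = (πK i / g₁) * ((∑ jj, πJ jj) / g₁) := by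
      intro i; rw [Finset.sum_div, Finset.mul_sum]
    rw [t1, Finset.sum_congr rfl fun i _ => t2 i, ← Finset.sum_mul, ← Finset.sum_div, hsumJ, hsumK, hd, div_self hg0.ne']
    have hne : g₁ ≠ 0 := hg0.ne'
    field_simp
    rw [hg₁]; ring
  · -- the mixture identity
    intro h
    have ec : cond (flaw J) = fun k => ∑ jj, (πJ jj / g₁) * FJ jj k := funext hc
    have eY : gate (flaw K) (1 / g₁) = fun k => d * (fun k => if k = 0 then (1 : ℝ) else 0) k + 1 * (fun k => ∑ i, (πK i / g₁) * FK i k) k := by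
      funext k; rw [hY k]; ring
    rw [ec, lconv_fsum_right, eY, Fintype.sum_prod_type, Finset.sum_comm]
    refine Finset.sum_congr rfl fun jj _ => ?_
    have FjM : ∀ k, ftop J < k → FJ jj k = 0 := fun k hk => (hPJ jj).2.2.1 k (lt_of_le_of_lt (hPJ jj).1 hk)
    rw [lconv_lin_left, lconv_delta_left (ftop K) (ftop J) _ FjM h, lconv_fsum_left, Fintype.sum_option]
    simp only [Option.elim]
    have C : ∀ i, lconv (ftop K) (ftop J) (FK i) (FJ jj) h = lconv (tK i) (tJ jj) (FK i) (FJ jj) h := by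
      intro i
      rw [lconv_top_left_of_le (tK i) (ftop K) (ftop J) (FK i) (FJ jj) (hPK i).1 (hPK i).2.2.1 h,
        lconv_top_right_of_le (tK i) (tJ jj) (ftop J) (FK i) (FJ jj) (hPJ jj).1 (hPJ jj).2.2.1 h]
    simp only [C, mul_add, Finset.mul_sum, one_mul]
    congr 1
    · ring
    · exact Finset.sum_congr rfl fun i _ => by ring
  · -- weighted means
    rw [Fintype.sum_prod_type, Fintype.sum_option]
    simp only [Option.elim]
    have t1 : ∑ jj, d * (πJ jj / g₁) * σJ jj = (d / g₁) * ∑ jj, πJ jj * σJ jj := by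
      rw [Finset.mul_sum]; exact Finset.sum_congr rfl fun jj _ => by ring
    have t2 : ∀ i, ∑ jj, πK i / g₁ * (πJ jj / g₁) * (σK i + σJ jj)
        = (πK i * σK i / g₁ ^ 2) * (∑ jj, πJ jj) + (πK i / g₁ ^ 2) * (∑ jj, πJ jj * σJ jj) := by
      intro i
      rw [Finset.mul_sum, Finset.mul_sum, ← Finset.sum_add_distrib]
      exact Finset.sum_congr rfl fun jj _ => by ring
    have t3 : ∑ i, πK i * σK i / g₁ ^ 2 = fmean K / g₁ ^ 2 := by rw [← Finset.sum_div, hπσK]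
    have t4 : ∑ i, πK i / g₁ ^ 2 = (1 - pdead K) / g₁ ^ 2 := by rw [← Finset.sum_div, hsumK]
    rw [t1, Finset.sum_congr rfl fun i _ => t2 i, Finset.sum_add_distrib, ← Finset.sum_mul, ← Finset.sum_mul, t3, t4, hπσJ, hsumJ,
      fmean_append, hd]
    have hne : g₁ ≠ 0 := hg0.ne'
    field_simp
    rw [hg₁]; ring
  · -- piece facts
    rintro ⟨o, jj⟩
    obtain ⟨htj, Fj0, FjM, Fj1, Fjmean, hSminj, hStotj, hTFj, hxmj, hxyj, hytj, hmgj, _⟩ := hPJ jj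
    obtain ⟨hyj0, hyj1, _, _, _, _⟩ := hTFj.lawFacts
    have hxm : xmin (J ++ K) ≤ yJ jj := by rw [xmin_append]; exact (min_le_left _ _).trans hxmj
    have hgK : ∀ L' : List Sib, 0 ≤ fgates L' := fun _ => Nat.zero_le _
    cases o with
    | none =>
      simp only [Option.elim]
      refine ⟨by omega, Fj0, FjM, Fj1, Fjmean, hSminj, ?_, hTFj, by rw [fgates_append]; omega, hxm, hyj0, hyj1, hytj⟩
      rw [Stot_append]; linarith [Stot_nonneg K hKl]
    | some i =>
      simp only [Option.elim]
      obtain ⟨hti, Fi0, FiM, Fi1, Fimean, _, hStoti, hTFi, hxmi, _, _, hmgi, _⟩ := hPK i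
      obtain ⟨hyi0, _, _, _, _, _⟩ := hTFi.lawFacts
      have hy0 : 0 < min (yK i) (yJ jj) := lt_min hyi0 hyj0
      have hTF : TreeBuiltN (min (yK i) (yJ jj)) (mK i + mJ jj) (tK i + tJ jj) (lconv (tK i) (tJ jj) (FK i) (FJ jj)) :=
        TreeBuiltN.conv (TreeBuiltN.mono hTFi hy0 (min_le_left _ _)) (TreeBuiltN.mono hTFj hy0 (min_le_right _ _))
      obtain ⟨_, hy1, L0, LM, L1, Lta⟩ := hTF.lawFacts
      have hσi : 0 ≤ σK i := by rw [← Fimean]; exact Finset.sum_nonneg fun h _ => mul_nonneg (Nat.cast_nonneg _) (Fi0 h)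
      refine ⟨by omega, L0, LM, L1, by rw [sum_mul_lconv _ _ _ _ Fi1 Fj1, Fimean, Fjmean], by linarith, ?_, hTF,
        by rw [fgates_append]; omega, ?_, hy0, hy1, ?_⟩
      · rw [Stot_append]; linarith
      · rw [xmin_append]; exact le_min ((min_le_right _ _).trans hxmi) ((min_le_left _ _).trans hxmj)
      · rw [sum_mul_lconv _ _ _ _ Fi1 Fj1, Fimean, Fjmean] at Lta; exact Lta

/-- **THE RESIDUAL PIECE IS DEC** (re-gating lemma + the node's oracle): with `g₁ = 1 − pdead J`, in the regime `a·fmean (J ++ K) ≤ Smin J` and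
under the floor check `x·Stot (J ++ K) ≤ fmean (J ++ K)·xmin (J ++ K)`, `gate (gate (flaw K) (1/g₁) ∗ cond (flaw J)) (a·g₁)` is DEC at every
layer at floor `a·x`. [this work] -/
theorem decAt_group_residual {x a : ℝ} (hx0 : 0 < x) (hx1 : x < 1) (J K : List Sib) (hJne : J ≠ [])
    (hJ : ∀ s ∈ J, s.TreeOK x) (hK : ∀ s ∈ K, s.TreeOK x) (hJ0 : ∀ s ∈ J, s.ρ 0 = 0) (hK0 : ∀ s ∈ K, s.ρ 0 = 0)
    (hO : ∀ (x' : ℝ) (n' M' : ℕ) (μ' : ℕ → ℝ), n' < fgates (J ++ K) → TreeBuiltN x' n' M' μ' → SDEC x' M' μ')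
    (ha0 : 0 < a) (hdom : pdead J ≤ pdead K) (hreg : a * fmean (J ++ K) ≤ Smin J)
    (hfl : x * Stot (J ++ K) ≤ fmean (J ++ K) * xmin (J ++ K)) :
    ∀ j, j < ftop K + ftop J → DECAt (a * x) j (ftop K + ftop J)
      (gate (lconv (ftop K) (ftop J) (gate (flaw K) (1 / (1 - pdead J))) (cond (flaw J))) (a * (1 - pdead J))) := by
  classical
  intro j hj
  have hJl : ∀ s ∈ J, s.LawOK := fun s hs => (hJ s hs).lawOK
  have hKl : ∀ s ∈ K, s.LawOK := fun s hs => (hK s hs).lawOK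
  obtain ⟨hpJ0, _, hpJlt⟩ := pdead_facts J hJl
  have hpJ1 : pdead J < 1 := hpJlt hJne
  set g₁ : ℝ := 1 - pdead J with hg₁
  have hg0 : 0 < g₁ := by rw [hg₁]; linarith
  have hJK : ∀ s ∈ J ++ K, s.TreeOK x := by
    intro s hs; rcases List.mem_append.1 hs with h | h; · exact hJ s h
    · exact hK s h
  have hS0 : 0 < fmean (J ++ K) := (fmean_pos (J ++ K) hJK).2 (by simp [hJne])
  obtain ⟨ι, _, π, t, m, s, y, F, hπ0, hπ1, hmix, hπs, hP⟩ := group_residual_mixture hx0 hx1 J K hJne hJ hK hJ0 hK0 hdom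
  -- mean of the residual law
  obtain ⟨f0J, fMJ, f1J, fmnJ⟩ := flaw_facts J hJl
  obtain ⟨f0K, fMK, f1K, fmnK⟩ := flaw_facts K hKl
  have hG0 : flaw J 0 = pdead J := flaw_zero_eq_pdead J hJ0
  obtain ⟨c0, cM, c1, cmean⟩ := cond_facts (ftop J) (flaw J) f0J fMJ f1J (by rw [hG0]; exact hpJ1)
  have hμmean : ∑ h ∈ Finset.range (ftop K + ftop J + 1),
      (h : ℝ) * lconv (ftop K) (ftop J) (gate (flaw K) (1 / g₁)) (cond (flaw J)) h = fmean (J ++ K) / g₁ := by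
    rw [sum_mul_lconv _ _ _ _ (sum_gate _ _ _ f1K) c1, sum_mul_gate, fmnK, cmean, fmnJ, hG0, fmean_append]
    rw [show (1 : ℝ) - pdead J = g₁ from hg₁.symm]
    field_simp
  have key := decAt_gate_of_regate (ftop K + ftop J) (lconv (ftop K) (ftop J) (gate (flaw K) (1 / g₁)) (cond (flaw J))) π F t s y
    (S := fmean (J ++ K) / g₁) (x := x / g₁) (a := a * g₁) hπ0 hπ1 hmix hπs (div_pos hS0 hg0) hμmean
    (fun i _ => by
      obtain ⟨hti, F0, FM, F1, Fmean, _, _, hTF, hmg, _, hy0, hy1, hyt⟩ := hP i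
      exact ⟨hti, F0, FM, F1, Fmean, hy0, hy1, hyt, hO _ _ _ _ (by omega) hTF⟩)
    (div_pos hx0 hg0) (mul_pos ha0 hg0)
    (fun i _ => by
      have e : a * g₁ * (fmean (J ++ K) / g₁) = a * fmean (J ++ K) := by field_simp
      rw [e]; exact hreg.trans (hP i).2.2.2.2.2.1)
    (fun i _ => by
      obtain ⟨_, _, _, _, _, _, hStot, _, _, hxm, _⟩ := hP i
      rw [div_mul_eq_mul_div, div_mul_eq_mul_div, div_le_div_iff_of_pos_right hg0]
      have h1 : x * s i ≤ x * Stot (J ++ K) := mul_le_mul_of_nonneg_left hStot hx0.le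
      have h2 : fmean (J ++ K) * xmin (J ++ K) ≤ fmean (J ++ K) * y i := mul_le_mul_of_nonneg_left hxm hS0.le
      linarith) j hj
  have e : a * g₁ * (x / g₁) = a * x := by field_simp
  rw [e] at key
  exact key

/-! ### The group-split theorem -/

/-- **GROUP-SPLIT RE-GATING (k-general).**  Siblings `J ++ K` (both groups nonempty; tree-built with root relays at floor `x`), GIVEN the
oracle below `fgates (J ++ K)`: if the hub group dominates (`pdead J ≤ pdead K`), for every outer gate `0 < a ≤ 1` with `a·fmean (J ++ K) ≤ Smin J`
and the uniform floor check, `gate (flaw (J ++ K)) a` is DEC at every layer at floor `a·x`. [this work] -/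
theorem decAt_gate_flaw_group {x a : ℝ} (hx0 : 0 < x) (hx1 : x < 1) (J K : List Sib) (hJne : J ≠ []) (hKne : K ≠ [])
    (hL : ∀ s ∈ J ++ K, s.TreeOK x) (h0 : ∀ s ∈ J ++ K, s.ρ 0 = 0)
    (hO : ∀ (x' : ℝ) (n' M' : ℕ) (μ' : ℕ → ℝ), n' < fgates (J ++ K) → TreeBuiltN x' n' M' μ' → SDEC x' M' μ')
    (ha0 : 0 < a) (ha1 : a ≤ 1) (hdom : pdead J ≤ pdead K) (hreg : a * fmean (J ++ K) ≤ Smin J)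
    (hfl : x * Stot (J ++ K) ≤ fmean (J ++ K) * xmin (J ++ K)) :
    ∀ j, j < ftop (J ++ K) → DECAt (a * x) j (ftop (J ++ K)) (gate (flaw (J ++ K)) a) := by
  classical
  intro j hj
  have hJ : ∀ s ∈ J, s.TreeOK x := fun s hs => hL s (List.mem_append_left K hs)
  have hK : ∀ s ∈ K, s.TreeOK x := fun s hs => hL s (List.mem_append_right J hs)
  have hJ0 : ∀ s ∈ J, s.ρ 0 = 0 := fun s hs => h0 s (List.mem_append_left K hs)
  have hK0 : ∀ s ∈ K, s.ρ 0 = 0 := fun s hs => h0 s (List.mem_append_right J hs)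
  have hJl : ∀ s ∈ J, s.LawOK := fun s hs => (hJ s hs).lawOK
  have hKl : ∀ s ∈ K, s.LawOK := fun s hs => (hK s hs).lawOK
  obtain ⟨f0J, fMJ, f1J, fmnJ⟩ := flaw_facts J hJl
  obtain ⟨f0K, fMK, f1K, fmnK⟩ := flaw_facts K hKl
  obtain ⟨hpJ0, _, hpJlt⟩ := pdead_facts J hJl
  have hpJ1 : pdead J < 1 := hpJlt hJne
  have hS0 : 0 < fmean (J ++ K) := (fmean_pos (J ++ K) hL).2 (by simp [hJne])
  -- both groups are SDEC by the oracle
  have hTJ : TreeBuiltN x (fgates J) (ftop J) (flaw J) := (compForestN_of_list hx0 hx1 J hJ).treeBuiltN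
  have hTK : TreeBuiltN x (fgates K) (ftop K) (flaw K) := (compForestN_of_list hx0 hx1 K hK).treeBuiltN
  have hgJ := fgates_pos J hJne
  have hgK := fgates_pos K hKne
  have hSJ : SDEC x (ftop J) (flaw J) := hO x (fgates J) _ _ (by rw [fgates_append]; omega) hTJ
  have hSK : SDEC x (ftop K) (flaw K) := hO x (fgates K) _ _ (by rw [fgates_append]; omega) hTK
  -- `flaw J = gate (cond (flaw J)) g₁`
  have hG0 : flaw J 0 = pdead J := flaw_zero_eq_pdead J hJ0
  set g₁ : ℝ := 1 - pdead J with hg₁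
  have hg0 : 0 < g₁ := by rw [hg₁]; linarith
  have hg1 : g₁ < 1 := by rw [hg₁]; linarith
  have hag : a * g₁ < 1 := lt_of_le_of_lt (mul_le_of_le_one_left hg0.le ha1) hg1
  have hGc : gate (cond (flaw J)) g₁ = flaw J := by
    have := gate_cond (flaw J) (by rw [hG0]; exact hpJ1); rwa [hG0] at this
  obtain ⟨c0, cM, c1, cmean⟩ := cond_facts (ftop J) (flaw J) f0J fMJ f1J (by rw [hG0]; exact hpJ1)
  -- the forest as `flaw K ∗ flaw J`
  rw [ftop_append] at hj ⊢
  rw [flaw_append J K hJl hKl]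
  -- THE IDENTITY
  set w : ℝ := (1 - g₁) / (1 - a * g₁) with hw
  have hw0 : 0 ≤ w := div_nonneg (by rw [hg₁]; linarith) (by linarith)
  have hw1 : w ≤ 1 := by rw [hw, div_le_one (by linarith)]; nlinarith
  have hident : ∀ h, gate (lconv (ftop K) (ftop J) (flaw K) (flaw J)) a h
      = w * lconv (ftop K) (ftop J) (gate (flaw K) a) (gate (flaw J) a) h
        + (1 - w) * gate (lconv (ftop K) (ftop J) (gate (flaw K) (1 / g₁)) (cond (flaw J))) (a * g₁) h := by
    have eP : gate (cond (flaw J)) (a * g₁) = gate (flaw J) a := by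
      conv_rhs => rw [← hGc]
      rw [gate_gate]
    intro h
    have e := hub_gateCoupling (ftop K) (ftop J) (flaw K) (cond (flaw J)) g₁ a fMK cM hg0.ne' (by linarith) h
    rw [hGc, eP] at e
    rw [e, hw]
  -- the two pieces
  have hP : DECAtT (a * x) (a * fmean (J ++ K)) j (ftop K + ftop J) (lconv (ftop K) (ftop J) (gate (flaw K) a) (gate (flaw J) a)) := by
    have := decAtT_gate_lconv_gate hx0 hx1 ha0 ha1 f0J fMJ f1J hTJ.lawFacts.2.2.2.2.2 f0K fMK f1K hTK.lawFacts.2.2.2.2.2 hSJ hSK j hj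
    rwa [fmnK, fmnJ, ← fmean_append] at this
  have hU : DECAtT (a * x) (a * fmean (J ++ K)) j (ftop K + ftop J)
      (gate (lconv (ftop K) (ftop J) (gate (flaw K) (1 / g₁)) (cond (flaw J))) (a * g₁)) := by
    have hd := decAt_group_residual hx0 hx1 J K hJne hJ hK hJ0 hK0 hO ha0 hdom hreg hfl j hj
    have hmean : ∑ h ∈ Finset.range (ftop K + ftop J + 1),
        (h : ℝ) * gate (lconv (ftop K) (ftop J) (gate (flaw K) (1 / g₁)) (cond (flaw J))) (a * g₁) h = a * fmean (J ++ K) := by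
      rw [sum_mul_gate, sum_mul_lconv _ _ _ _ (sum_gate _ _ _ f1K) c1, sum_mul_gate, fmnK, cmean, fmnJ, hG0, fmean_append]
      rw [show (1 : ℝ) - pdead J = g₁ from hg₁.symm]
      field_simp
    rw [decAt_iff_decAtT, hmean] at hd
    exact hd
  -- assemble
  have hmeanF : ∑ h ∈ Finset.range (ftop K + ftop J + 1), (h : ℝ) * gate (lconv (ftop K) (ftop J) (flaw K) (flaw J)) a h
      = a * fmean (J ++ K) := by
    rw [sum_mul_gate, sum_mul_lconv _ _ _ _ f1K f1J, fmnK, fmnJ, fmean_append]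
  rw [decAt_iff_decAtT, hmeanF]
  exact decAtT_congr (fun h => (hident h).symm) (decAtT_mixture w hw0 hw1 hP hU)

/-- **THE SIBLING STEP HOLDS FOR A DOMINANT LIGHT HUB GROUP (any width).**  If moreover `fmean (J ++ K) ≤ Smin J` then the forest law is SDEC at
`x`, given the oracle (the list form of `SiblingStep` on this family; use `flaw_perm` for other positions of the hub group). [this work] -/
theorem sdec_flaw_group {x : ℝ} (hx0 : 0 < x) (hx1 : x < 1) (J K : List Sib) (hJne : J ≠ []) (hKne : K ≠ [])
    (hL : ∀ s ∈ J ++ K, s.TreeOK x) (h0 : ∀ s ∈ J ++ K, s.ρ 0 = 0)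
    (hO : ∀ (x' : ℝ) (n' M' : ℕ) (μ' : ℕ → ℝ), n' < fgates (J ++ K) → TreeBuiltN x' n' M' μ' → SDEC x' M' μ')
    (hdom : pdead J ≤ pdead K) (hlight : fmean (J ++ K) ≤ Smin J) (hfl : x * Stot (J ++ K) ≤ fmean (J ++ K) * xmin (J ++ K)) :
    SDEC x (ftop (J ++ K)) (flaw (J ++ K)) := by
  intro a ha0 ha1 j hj
  refine decAt_gate_flaw_group hx0 hx1 J K hJne hKne hL h0 hO ha0 ha1 hdom ?_ hfl j hj
  have : a * fmean (J ++ K) ≤ 1 * fmean (J ++ K) := mul_le_mul_of_nonneg_right ha1 (fmean_pos (J ++ K) hL).1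
  linarith

end LawDec
end Quant
end Summit.CriticalPhenomena.PercolationContinuityZ3.Theorems
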